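import Summits.SmoothPoincare4.SmoothPoincare4.Theorems.ConvexBisectionAcyclicBisectionExistsBeltFramingFamilies
import Literature.Geometry.Symplectic.LegendrianRealisationProofs
import Literature.Geometry.Manifold.OpenSubmanifoldTangent
import HarnessLib

/-!
# Pushing framed knot isotopies of the base piece through `jA` into the attached manifold
(node T3c-1 `node_belt_isotopic_pushoff` of the sub-goal T3 of stub `stub_steinRealisation` (NF6), line
`modp-braid-orbits`, crux `ConvexBisection.AcyclicBisectionExists`, item stmt-SmoothPoincare4-10508;
wave 3, worker Z5, lead c5; plumbing for stages (3a)–(3d) of V6-REPORT §2)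

For multi-attachment data `D` (`P = M ∪_{h̄} handles`, `jA : M ∖ ⋃ cores ↪ P`), a framed isotopy of
knots in `∂M` whose stages avoid the cores is pushed by `jA` and its differential to a framed isotopy of
knots in `∂P`:

* §1 **sections of the tangent bundle of an open submanifold**: a vector field along a map into an open
  `U ⊆ M` that is continuous into `TM` is continuous into `TU` (`continuous_totalSpace_mk_opens`; the
  coordinate changes of `TU` are those of `TM`, `Literature.Geometry.Manifold.OpenSubmanifold.tangentCoordChange_eq`);
* §2 `jA`-pushes: of a smooth embedding of the circle (`isSmoothEmbedding_jA_comp`), of a knot framing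
  (`isKnotFraming_jA_push`), of an isotopy of knots in `∂M` (`isotopyJA`), of a framing family carried
  along it (`isFramingAlong_jA_push`), and of a homotopy of framings (`framingHomotopic_jA_push`);
* §3 registered helper `helper_belt_basePush`.

Everything is proved; no named facts.

## References
* A. A. Kosinski, *Differential Manifolds*, Academic Press (1993), VI §6. [Kosinski1993]
* J. M. Lee, *Introduction to Smooth Manifolds* (2013), Ch. 3 (tangent bundle), Ch. 5. [LeeSmoothManifolds2013]
-/

noncomputable section

-- the prescribed namespace `Summit.<P>.<Sub>.…` duplicates `SmoothPoincare4` (P = Sub)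
set_option linter.dupNamespace false

open scoped Manifold ContDiff Topology
open Set Function Metric Bundle

namespace Summit.SmoothPoincare4.SmoothPoincare4.Theorems.AcyclicBisectionExists.ModpBraidOrbits

open Literature.Topology.FourManifolds Literature.Topology.FourManifolds.HandleAttachingMap
  Literature.Geometry.Symplectic

/-! ### §1 Sections of the tangent bundle of an open submanifold -/

section Opens

variable {E H : Type*} [NormedAddCommGroup E] [NormedSpace ℝ E] [TopologicalSpace H]
  {I : ModelWithCorners ℝ E H} {M : Type*} [TopologicalSpace M] [ChartedSpace H M]

variable [IsManifold I ∞ M]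

/-- **A vector field along a map into an open submanifold `U` which is continuous into `TM` is continuous
into `TU`.** [cite: LeeSmoothManifolds2013, Ch. 3] -/
theorem continuous_totalSpace_mk_opens {Z : Type*} [TopologicalSpace Z] (U : TopologicalSpace.Opens M)
    {c : Z → U} {v : Z → E}
    (h : Continuous fun z => (TotalSpace.mk' E (c z : M) (v z) : TangentBundle I M)) :
    Continuous fun z => (TotalSpace.mk' E (c z) (v z) : TangentBundle I U) := by
  refine continuous_iff_continuousAt.2 fun z₀ => ?_
  rw [FiberBundle.continuousAt_totalSpace]
  have h' := (FiberBundle.continuousAt_totalSpace E _).1 (h.continuousAt (x := z₀))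
  refine ⟨?_, ?_⟩
  · have hb : ContinuousAt (fun z => (c z : M)) z₀ := h'.1
    exact (Topology.IsInducing.subtypeVal.continuousAt_iff).2 hb
  · -- the fibre coordinates of `TU` are those of `TM` (`OpenSubmanifold.tangentCoordChange_eq`)
    refine h'.2.congr (Filter.Eventually.of_forall fun z => ?_)
    change tangentCoordChange I ((c z : U) : M) ((c z₀ : U) : M) ((c z : U) : M) (v z) =
      tangentCoordChange I (c z) (c z₀) (c z) (v z)
    rw [Literature.Geometry.Manifold.OpenSubmanifold.tangentCoordChange_eq (c z) (c z₀) (c z) (mem_chart_source H _)]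

/-- `ContinuousOn` version of `continuous_totalSpace_mk_opens`. [folklore] -/
theorem continuousOn_totalSpace_mk_opens {Z : Type*} [TopologicalSpace Z] (U : TopologicalSpace.Opens M)
    {c : Z → U} {v : Z → E} {S : Set Z}
    (h : ContinuousOn (fun z => (TotalSpace.mk' E (c z : M) (v z) : TangentBundle I M)) S) :
    ContinuousOn (fun z => (TotalSpace.mk' E (c z) (v z) : TangentBundle I U)) S := by
  rw [continuousOn_iff_continuous_restrict] at h ⊢
  exact continuous_totalSpace_mk_opens U (c := fun z : S => c z) h

end Opens

/-! ### §2 Pushing through `jA` -/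

section Push

variable {ι : Type*} [Finite ι] {M : Type*} [TopologicalSpace M] [T2Space M]
  [ChartedSpace (EuclideanHalfSpace 4) M] [IsManifold (𝓡∂ 4) ∞ M] {h : ι → HandleAttachingMap 3 2 M}
  {P : Type*} [TopologicalSpace P] [T2Space P] [ChartedSpace (EuclideanHalfSpace 4) P] [IsManifold (𝓡∂ 4) ∞ P]
  (D : MultiAttachmentData h (𝓡∂ 4) P)

/-- **A smooth embedding of the circle off the cores is pushed by `jA` to a smooth embedding.** [folklore] -/
theorem isSmoothEmbedding_jA_comp {K : sphere (0 : EuclideanSpace ℝ (Fin 2)) 1 → M}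
    (hK : Manifold.IsSmoothEmbedding (𝓡 1) (𝓡∂ 4) ∞ K) (hKc : ∀ u, K u ∈ coresComplement h) :
    Manifold.IsSmoothEmbedding (𝓡 1) (𝓡∂ 4) ∞ fun u => D.jA ⟨K u, hKc u⟩ := by
  have hemb : Manifold.IsSmoothEmbedding (𝓡 1) (𝓡∂ 4) ∞
      fun u => (⟨K u, hKc u⟩ : ↥(coresComplement h)) :=
    hK.codRestrict_opens (coresComplement h) hKc
  have ho : Topology.IsOpenEmbedding D.jA := ⟨D.hjA.isEmbedding, D.hjAo⟩
  haveI : Nonempty ↥(coresComplement h) := ⟨⟨K (circlePt 0), hKc _⟩⟩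
  set Φ := ho.toOpenPartialHomeomorph D.jA with hΦ
  have hsrc : Φ.source = univ := ho.toOpenPartialHomeomorph_source _
  have hcoe : ⇑Φ = D.jA := ho.toOpenPartialHomeomorph_apply _
  have hΦsm : ContMDiffOn (𝓡∂ 4) (𝓡∂ 4) ∞ Φ Φ.source := by
    rw [hcoe]; exact D.hjA.contMDiff.contMDiffOn
  have hΦ'sm : ContMDiffOn (𝓡∂ 4) (𝓡∂ 4) ∞ Φ.symm Φ.target := by
    rw [ho.toOpenPartialHomeomorph_target]
    exact contMDiffOn_symm_of_isSmoothEmbedding D.hjA ho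
  have himm := hemb.isImmersion.openPartialHomeomorph_comp Φ hΦsm hΦ'sm
    (fun u => by rw [hsrc]; exact mem_univ _)
  rw [hcoe] at himm
  have hinj : Injective fun u => D.jA ⟨K u, hKc u⟩ :=
    D.hjA.isEmbedding.injective.comp hemb.isEmbedding.injective
  have hcont : Continuous fun u => D.jA ⟨K u, hKc u⟩ :=
    D.hjA.contMDiff.continuous.comp hemb.contMDiff.continuous
  exact ⟨himm, (hcont.isClosedEmbedding hinj).isEmbedding⟩

omit [T2Space P] in
/-- **A knot framing in `∂M` off the cores is pushed by `d(jA)` to a knot framing in `∂P`.**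
[cite: Kosinski1993, VI §6] -/
theorem isKnotFraming_jA_push {K : sphere (0 : EuclideanSpace ℝ (Fin 2)) 1 → M}
    {ν : sphere (0 : EuclideanSpace ℝ (Fin 2)) 1 → EuclideanSpace ℝ (Fin 4)} (hK : IsBoundaryKnot K)
    (hKc : ∀ u, K u ∈ coresComplement h) (hν : IsKnotFraming K ν) :
    IsKnotFraming (fun u => D.jA ⟨K u, hKc u⟩) fun u => mfderiv (𝓡∂ 4) (𝓡∂ 4) D.jA ⟨K u, hKc u⟩ (ν u) where
  continuous := by
    have h1 : Continuous (tangentMap (𝓡∂ 4) (𝓡∂ 4) D.jA) := D.hjA.contMDiff.continuous_tangentMap (by simp)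
    have h2 := continuous_totalSpace_mk_opens (I := 𝓡∂ 4) (coresComplement h)
      (c := fun u => (⟨K u, hKc u⟩ : ↥(coresComplement h))) hν.continuous
    exact (h1.comp h2).congr fun u => rfl
  mem_boundaryTangentSpace u :=
    mfderiv_jA_mem_boundaryTangentSpace D ⟨K u, hKc u⟩ (hK.isBoundaryPoint u) (hν.mem_boundaryTangentSpace u)
  not_mem_span t := by
    rw [knotVelocity_jA_comp D hK.isSmoothEmbedding.contMDiff hKc t, Submodule.mem_span_singleton]
    rintro ⟨c, hc⟩
    have hinj := injective_mfderiv_jA D ⟨K (circlePt t), hKc _⟩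
    refine hν.not_mem_span t (Submodule.mem_span_singleton.2 ⟨c, hinj ?_⟩)
    exact ((mfderiv (𝓡∂ 4) (𝓡∂ 4) D.jA ⟨K (circlePt t), hKc _⟩).map_smul c (knotVelocity K t)).trans hc

variable {K K' : sphere (0 : EuclideanSpace ℝ (Fin 2)) 1 → M}

/-- **An isotopy of knots in `∂M` whose stages avoid the cores is pushed by `jA` to an isotopy of knots
in `∂P`.** [cite: Kosinski1993, VI §6] -/
def isotopyJA (Φ : KnotIsotopyInBoundary K K') (hc : ∀ t u, Φ.toFun t u ∈ coresComplement h) :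
    KnotIsotopyInBoundary (fun u => D.jA ⟨K u, Φ.map_zero ▸ hc 0 u⟩)
      (fun u => D.jA ⟨K' u, Φ.map_one ▸ hc 1 u⟩) where
  toFun t u := D.jA ⟨Φ.toFun t u, hc t u⟩
  contMDiff := by
    have h1 : ContMDiff (𝓘(ℝ, ℝ).prod (𝓡 1)) (𝓡∂ 4) ∞
        fun p : ℝ × (sphere (0 : EuclideanSpace ℝ (Fin 2)) 1) => (⟨Φ.toFun p.1 p.2, hc p.1 p.2⟩ : ↥(coresComplement h)) :=
      (ContMDiff.subtypeVal_comp_iff (coresComplement h) _).1 Φ.contMDiff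
    exact D.hjA.contMDiff.comp h1
  isSmoothEmbedding t := isSmoothEmbedding_jA_comp D (Φ.isSmoothEmbedding t) (hc t)
  map_zero := by
    have key : ∀ (G : sphere (0 : EuclideanSpace ℝ (Fin 2)) 1 → M) (hG : ∀ u, G u ∈ coresComplement h)
        (e : G = K), (fun u => D.jA ⟨G u, hG u⟩) = fun u => D.jA ⟨K u, e ▸ hG u⟩ := by
      intro G hG e; subst e; rfl
    exact key _ (hc 0) Φ.map_zero
  map_one := by
    have key : ∀ (G : sphere (0 : EuclideanSpace ℝ (Fin 2)) 1 → M) (hG : ∀ u, G u ∈ coresComplement h)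
        (e : G = K'), (fun u => D.jA ⟨G u, hG u⟩) = fun u => D.jA ⟨K' u, e ▸ hG u⟩ := by
      intro G hG e; subst e; rfl
    exact key _ (hc 1) Φ.map_one
  isBoundaryPoint t ht u := (isBoundaryPoint_jA_iff D _).2 (Φ.isBoundaryPoint t ht u)

/-- Stages of the pushed isotopy. [folklore] -/
@[simp] theorem isotopyJA_toFun (Φ : KnotIsotopyInBoundary K K') (hc : ∀ t u, Φ.toFun t u ∈ coresComplement h)
    (t : ℝ) (u : sphere (0 : EuclideanSpace ℝ (Fin 2)) 1) :
    (isotopyJA D Φ hc).toFun t u = D.jA ⟨Φ.toFun t u, hc t u⟩ := rfl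


/-- The pushed isotopy with its endpoints written as the pushed stages `0` and `1`. [folklore] -/
def isotopyCast' (Φ : KnotIsotopyInBoundary K K') (hc : ∀ t u, Φ.toFun t u ∈ coresComplement h) :
    KnotIsotopyInBoundary (fun u => D.jA ⟨Φ.toFun 0 u, hc 0 u⟩) (fun u => D.jA ⟨Φ.toFun 1 u, hc 1 u⟩) where
  toFun t u := D.jA ⟨Φ.toFun t u, hc t u⟩
  contMDiff := (isotopyJA D Φ hc).contMDiff
  isSmoothEmbedding := (isotopyJA D Φ hc).isSmoothEmbedding
  map_zero := rfl
  map_one := rfl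
  isBoundaryPoint := (isotopyJA D Φ hc).isBoundaryPoint

/-- **A framing family carried along an isotopy of knots in `∂M` off the cores is pushed by `d(jA)` to a
framing family carried along the pushed isotopy.** [cite: Kosinski1993, VI §6] -/
theorem isFramingAlong_jA_push {Φ : KnotIsotopyInBoundary K K'} (hc : ∀ t u, Φ.toFun t u ∈ coresComplement h)
    {ν : sphere (0 : EuclideanSpace ℝ (Fin 2)) 1 → EuclideanSpace ℝ (Fin 4)}
    {νt : ℝ → sphere (0 : EuclideanSpace ℝ (Fin 2)) 1 → EuclideanSpace ℝ (Fin 4)} (hν : IsFramingAlong Φ ν νt) :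
    IsFramingAlong (isotopyJA D Φ hc) (fun u => mfderiv (𝓡∂ 4) (𝓡∂ 4) D.jA ⟨K u, Φ.map_zero ▸ hc 0 u⟩ (ν u))
      fun t u => mfderiv (𝓡∂ 4) (𝓡∂ 4) D.jA ⟨Φ.toFun t u, hc t u⟩ (νt t u) where
  apply_zero := by
    have key : ∀ (G : sphere (0 : EuclideanSpace ℝ (Fin 2)) 1 → M) (hG : ∀ u, G u ∈ coresComplement h)
        (e : G = K) (μ : sphere (0 : EuclideanSpace ℝ (Fin 2)) 1 → EuclideanSpace ℝ (Fin 4)) (_ : μ = ν),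
        (fun u => mfderiv (𝓡∂ 4) (𝓡∂ 4) D.jA ⟨G u, hG u⟩ (μ u)) =
          fun u => mfderiv (𝓡∂ 4) (𝓡∂ 4) D.jA ⟨K u, e ▸ hG u⟩ (ν u) := by
      intro G hG e μ eμ; subst e; subst eμ; rfl
    exact key _ (hc 0) Φ.map_zero _ hν.apply_zero
  isKnotFraming t ht := isKnotFraming_jA_push D (Φ.isBoundaryKnot ht) (hc t) (hν.isKnotFraming t ht)
  continuousOn := by
    have h1 : Continuous (tangentMap (𝓡∂ 4) (𝓡∂ 4) D.jA) := D.hjA.contMDiff.continuous_tangentMap (by simp)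
    have h2 := continuousOn_totalSpace_mk_opens (I := 𝓡∂ 4) (coresComplement h)
      (c := fun p : ℝ × (sphere (0 : EuclideanSpace ℝ (Fin 2)) 1) => (⟨Φ.toFun p.1 p.2, hc p.1 p.2⟩ : ↥(coresComplement h)))
      hν.continuousOn
    exact (h1.comp_continuousOn h2).congr fun p _ => rfl

/-- A framing family along an isotopy is a framing family along any isotopy with the same stages.
[folklore] -/
private theorem isFramingAlong_congr_stages {W : Type*} [TopologicalSpace W] [ChartedSpace (EuclideanHalfSpace 4) W]
    [IsManifold (𝓡∂ 4) ∞ W] {K₀ K₁ L₀ L₁ : sphere (0 : EuclideanSpace ℝ (Fin 2)) 1 → W}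
    {Φ : KnotIsotopyInBoundary K₀ K₁} {Ψ : KnotIsotopyInBoundary L₀ L₁}
    {ν : sphere (0 : EuclideanSpace ℝ (Fin 2)) 1 → EuclideanSpace ℝ (Fin 4)}
    {νt : ℝ → sphere (0 : EuclideanSpace ℝ (Fin 2)) 1 → EuclideanSpace ℝ (Fin 4)} (hν : IsFramingAlong Φ ν νt)
    (e : ∀ t, Ψ.toFun t = Φ.toFun t) : IsFramingAlong Ψ ν νt where
  apply_zero := hν.apply_zero
  isKnotFraming t ht := by rw [e t]; exact hν.isKnotFraming t ht
  continuousOn := by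
    refine hν.continuousOn.congr fun p _ => ?_
    show (TotalSpace.mk' (EuclideanSpace ℝ (Fin 4)) (Ψ.toFun p.1 p.2) (νt p.1 p.2) : TangentBundle (𝓡∂ 4) W) = _
    rw [e p.1]

/-- **A homotopy of framings of a knot in `∂M` off the cores is pushed by `d(jA)` to a homotopy of
framings of the pushed knot.** [cite: Kosinski1993, VI §6] -/
theorem framingHomotopic_jA_push {K : sphere (0 : EuclideanSpace ℝ (Fin 2)) 1 → M} (hKc : ∀ u, K u ∈ coresComplement h)
    {ν ν' : sphere (0 : EuclideanSpace ℝ (Fin 2)) 1 → EuclideanSpace ℝ (Fin 4)} (hν : FramingHomotopic K ν ν') :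
    FramingHomotopic (fun u => D.jA ⟨K u, hKc u⟩) (fun u => mfderiv (𝓡∂ 4) (𝓡∂ 4) D.jA ⟨K u, hKc u⟩ (ν u))
      fun u => mfderiv (𝓡∂ 4) (𝓡∂ 4) D.jA ⟨K u, hKc u⟩ (ν' u) := by
  obtain ⟨hK, νt, hνt, h1⟩ := hν
  have hK' : IsBoundaryKnot fun u => D.jA ⟨K u, hKc u⟩ := isBoundaryKnot_jA_comp D hK hKc
  have hpush := isFramingAlong_jA_push D (Φ := KnotIsotopyInBoundary.refl hK) (fun t u => hKc u) hνt
  refine ⟨hK', fun t u => mfderiv (𝓡∂ 4) (𝓡∂ 4) D.jA ⟨K u, hKc u⟩ (νt t u),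
    isFramingAlong_congr_stages hpush (fun t => rfl), ?_⟩
  funext u
  exact congrArg (mfderiv (𝓡∂ 4) (𝓡∂ 4) D.jA ⟨K u, hKc u⟩) (congrFun h1 u)

end Push


/-! ### §3 Registered helper -/

/-- **Registered helper `helper_belt_basePush` (node T3c-1 of NF6 `stub_steinRealisation`, plumbing for
stages (3a)–(3d), wave 3, lead c5): an isotopy of knots in `∂M` whose stages avoid the cores of a
multi-attachment, with a framing family carried along it, is pushed by `jA` and `d(jA)` to an isotopy of
knots in `∂P` carrying the pushed framings; likewise a homotopy of framings.** [cite: Kosinski1993, VI §6] -/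
theorem helper_belt_basePush :
    ∀ {ι : Type} [Finite ι] {M : Type} [TopologicalSpace M] [T2Space M] [ChartedSpace (EuclideanHalfSpace 4) M]
      [IsManifold (𝓡∂ 4) ∞ M] {h : ι → Literature.Topology.FourManifolds.HandleAttachingMap 3 2 M}
      {P : Type} [TopologicalSpace P] [T2Space P] [ChartedSpace (EuclideanHalfSpace 4) P] [IsManifold (𝓡∂ 4) ∞ P]
      (D : Literature.Topology.FourManifolds.HandleAttachingMap.MultiAttachmentData h (𝓡∂ 4) P)
      {K K' : Metric.sphere (0 : EuclideanSpace ℝ (Fin 2)) 1 → M}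
      (Φ : Literature.Geometry.Symplectic.KnotIsotopyInBoundary K K')
      (hc : ∀ t u, Φ.toFun t u ∈ Literature.Topology.FourManifolds.HandleAttachingMap.coresComplement h)
      (ν : Metric.sphere (0 : EuclideanSpace ℝ (Fin 2)) 1 → EuclideanSpace ℝ (Fin 4))
      (νt : ℝ → Metric.sphere (0 : EuclideanSpace ℝ (Fin 2)) 1 → EuclideanSpace ℝ (Fin 4)),
      Literature.Geometry.Symplectic.IsFramingAlong Φ ν νt →
      (∃ Ψ : Literature.Geometry.Symplectic.KnotIsotopyInBoundary
          (fun u => D.jA ⟨Φ.toFun 0 u, hc 0 u⟩) (fun u => D.jA ⟨Φ.toFun 1 u, hc 1 u⟩),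
        (∀ t u, Ψ.toFun t u = D.jA ⟨Φ.toFun t u, hc t u⟩) ∧
        Literature.Geometry.Symplectic.IsFramingAlong Ψ (fun u => mfderiv (𝓡∂ 4) (𝓡∂ 4) D.jA ⟨Φ.toFun 0 u, hc 0 u⟩ (νt 0 u))
          fun t u => mfderiv (𝓡∂ 4) (𝓡∂ 4) D.jA ⟨Φ.toFun t u, hc t u⟩ (νt t u)) ∧
      ∀ (ν' : Metric.sphere (0 : EuclideanSpace ℝ (Fin 2)) 1 → EuclideanSpace ℝ (Fin 4))
        (hKc : ∀ u, K u ∈ Literature.Topology.FourManifolds.HandleAttachingMap.coresComplement h),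
        Literature.Geometry.Symplectic.FramingHomotopic K ν ν' →
        Literature.Geometry.Symplectic.FramingHomotopic (fun u => D.jA ⟨K u, hKc u⟩)
          (fun u => mfderiv (𝓡∂ 4) (𝓡∂ 4) D.jA ⟨K u, hKc u⟩ (ν u))
          fun u => mfderiv (𝓡∂ 4) (𝓡∂ 4) D.jA ⟨K u, hKc u⟩ (ν' u) := by
  intro ι _ M _ _ _ _ h P _ _ _ _ D K K' Φ hc ν νt hν
  refine ⟨?_, fun ν' hKc hh => framingHomotopic_jA_push D hKc hh⟩
  -- the pushed isotopy, re-based at the stage-`0`/stage-`1` endpoints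
  have key : ∀ (K₀ K₁ : Metric.sphere (0 : EuclideanSpace ℝ (Fin 2)) 1 → M) (Φ' : KnotIsotopyInBoundary K₀ K₁)
      (e0 : Φ'.toFun 0 = K₀) (e1 : Φ'.toFun 1 = K₁) (hc' : ∀ t u, Φ'.toFun t u ∈ coresComplement h)
      (μ : Metric.sphere (0 : EuclideanSpace ℝ (Fin 2)) 1 → EuclideanSpace ℝ (Fin 4)) (hμ : IsFramingAlong Φ' μ νt),
      ∃ Ψ : KnotIsotopyInBoundary (fun u => D.jA ⟨Φ'.toFun 0 u, hc' 0 u⟩) (fun u => D.jA ⟨Φ'.toFun 1 u, hc' 1 u⟩),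
        (∀ t u, Ψ.toFun t u = D.jA ⟨Φ'.toFun t u, hc' t u⟩) ∧
        IsFramingAlong Ψ (fun u => mfderiv (𝓡∂ 4) (𝓡∂ 4) D.jA ⟨Φ'.toFun 0 u, hc' 0 u⟩ (νt 0 u))
          fun t u => mfderiv (𝓡∂ 4) (𝓡∂ 4) D.jA ⟨Φ'.toFun t u, hc' t u⟩ (νt t u) := by
    intro K₀ K₁ Φ' _ _ hc' μ hμ
    refine ⟨isotopyCast' D Φ' hc', fun t u => rfl, ?_⟩
    have hp := isFramingAlong_jA_push D hc' hμ
    have eμ : μ = νt 0 := hμ.apply_zero.symm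
    subst eμ
    have eν : (fun u => mfderiv (𝓡∂ 4) (𝓡∂ 4) D.jA ⟨K₀ u, Φ'.map_zero ▸ hc' 0 u⟩ (νt 0 u)) =
        fun u => mfderiv (𝓡∂ 4) (𝓡∂ 4) D.jA ⟨Φ'.toFun 0 u, hc' 0 u⟩ (νt 0 u) := by
      have key' : ∀ (G : Metric.sphere (0 : EuclideanSpace ℝ (Fin 2)) 1 → M) (hG : ∀ u, G u ∈ coresComplement h)
          (_ : Φ'.toFun 0 = G), (fun u => mfderiv (𝓡∂ 4) (𝓡∂ 4) D.jA ⟨G u, hG u⟩ (νt 0 u)) =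
            fun u => mfderiv (𝓡∂ 4) (𝓡∂ 4) D.jA ⟨Φ'.toFun 0 u, hc' 0 u⟩ (νt 0 u) := by
        intro G hG e; subst e; rfl
      exact key' _ _ Φ'.map_zero
    rw [eν] at hp
    exact isFramingAlong_congr_stages hp fun t => rfl
  exact key K K' Φ Φ.map_zero Φ.map_one hc ν hν

end Summit.SmoothPoincare4.SmoothPoincare4.Theorems.AcyclicBisectionExists.ModpBraidOrbits

end
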